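/-
Copyright (c) 2026 the pub-hodgecm-mathlib formalisation cell (harness21).  Prover seat hodgecm-mathlib-LH4-p17 (g3) (Track A «FOUR-FRAME» free hand routed to L1 by the
CHAIR VALVE; LEAD F0P6-plan (g15) BATCH #243 «(D-arch-P)»; block-D desk K2Liu-p12 (g6) WORD #10 «cut (α), FILE B keeps the dealt name, head `…_of_flatTubePresentation`»;
package F0P2-p11 (g3); consumers ★ p864260 `K2LiuIncoherentRankOneArchPlaceTensor` (letters `hAint hpure hAraw`) and `K2LiuIncoherentRankOneFaceRefinement` (letter `hdec`)),
Track B «K2-LIT», #184♮ = hLiu418 = `stmt-HodgeConjecture-24832`.  THEOREMS ONLY (no `def`, no instance, no notation, no named-fact hypothesis, no `sorry`, default heartbeats).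
-/
import Summits.HodgeConjecture.HodgeConjecture.Theorems.K2LiuIncoherentRankOneArchSplitOfFaces   -- ★ p863921 (this seat): the frame vocabulary
import Mathlib.MeasureTheory.Integral.Bochner.Basic                                              -- `integral_finsetSum`
import HarnessLib

/-!
# Crux `HLiu418`, #42S organ S5, BLOCK D row D-1 — (D-arch-P) THE PURE-TENSOR PRESENTATION OF A REFINED FACE'S ARCHIMEDEAN INTEGRAND THROUGH THE TUBE FRAME
# (`hpure`∕`hAint`∕`hAraw` of ★ p864260 and the raw face decomposition `hdec` of `K2LiuIncoherentRankOneFaceRefinement`, from the character's frame reading, the flat tube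
# presentation of the (KW-fac) face and the multiplicativity of the frame — all BY VALUE)

Cell `hodgecm-mathlib`, crux item hLiu418 = `stmt-HodgeConjecture-24832`, route `HCCMUnconditional`; squad K2 ∕ K2Liu (L1, LEAD F0P6-plan (g15)).  Lane
`--supports stmt-HodgeConjecture-24832 --as helper` (count-neutral).  CLOSES NO SOCKET.

THE SETTING (this seat's CENSUS 2026-09-05T01:54:58Z, desk K2Liu-p12 (g6) WORD #10 «=»).  The raw archimedean block of the (KW-fac) face `j` is (★ p863805 (b))
  `A X j s h = ∫_{N_Δ(L⁺⊗ℝ)} χ_X(u) · Finf j s (x · u · g′_{X,h}) dν_{X,h}(u)`,   `χ_X(u) = conj ψ_{σ♭_X E_bb}(ι_∞ u)`, `x = (w_Δ)_∞`, `g′_{X,h} = (gc X · h)_∞`,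
and the tree READS both factors through the tube frame `Fr`:
(E) the CHARACTER is place-pure — ★ p863743 `K2LiuKindWArchCharacterFrameReading.conj_unipDeltaChar_archToAdelic_eq_prod{_re}`: `χ_X(u) = ∏_w eb_{X,w}((Fr u w)₁₂)`;
(T) the FACE is a finite SUM of place-pure flat tube products — ★ `K2LiuArchFlatTubePresentation.exists_flat_tube_presentation`:
  `Finf j s a = Σ_{r ∈ R j} γ_{j,r}(s) · ∏_w Fs_{j,r,w}(s)(Fr (a·g) w)`   (`γ_{j,r}(s) = H_𝒦(g⁻¹)^{2(s−s₀)}·c_r`, entire in `s`);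
(M) the FRAME is multiplicative — ★ `K2LiuHolTubeRigidityOfFrame.frame_mul`: `Fr (x·u·g″) w = Fr x w · Fr u w · Fr g″ w`.
Hence, per REFINED face `p = (j, r)` (the faces of `K2LiuIncoherentRankOneFaceRefinement`), the integrand IS a pure tensor through the frame:
  `χ_X(u) · γ_p(s) · ∏_w Fs_{p,w}(s)(Fr(x·u·g″) w) = ∏_w Ψloc_{X,p,w,s,h}(Fr u w)`,   `Ψloc(m) := [w = w₀ ? γ_p(s) : 1] · eb_{X,w}(m₁₂) · Fs_{p,w}(s)(Fr x w · m · Fr g″_{X,h} w)`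
— the `s`-dependent scalar folded into the factor at ONE fixed complex place `w₀` (desk check (a): so ★ p864260's `cA` stays the `s`-free Haar constant), the dependence on the adelic
point `h` sitting ONLY in the right frame factor `Fr g″_{X,h} w` (= the component `comp X h w` of ★ p864236 ∕ ★ p864260's `hAraw` — desk∕second-reader NB); and the raw block is the SUM
over `r` of the integrals of these pure tensors (Bochner `integral_finsetSum`, per-term integrability on `{1 < re}` BY VALUE — ★ `K2LiuArchBlockOfFrameEnd.integrable_prod_unipDeltaArch_of_record`
× the unimodular character).
THIS FILE is hypothesis-first and GENERIC in the measure space `Ω` (of record `N_Δ(L⁺⊗ℝ)`), the frame target `M` (of record `M₄(ℂ)`), the block type `B` (of record `M₂(ℂ)`, `blk = toBlocks₁₂`)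
and the place type `σ` (of record `{w ∣ complex}`); the readings (E) (T) (M) enter as the letters `heb hpres hFrpt`, the integral reading of `A` as `hAint₀`:
* §1 **`charTerm_eq_prod_frameTensor`** — the algebra: `χ · (γ · ∏_w Fs_w(Frx_w · Fru_w · Frg_w)) = ∏_w ([w = w₀ ? γ : 1] · eb_w(blk (Fru_w)) · Fs_w(Frx_w · Fru_w · Frg_w))`
  given `χ = ∏_w eb_w(blk (Fru_w))` (`Finset.prod_mul_distrib`, `Finset.prod_ite_eq'`);  **`integral_mul_eq_sum_integral_of_presentation`** — `∫ χ·F dν = Σ_r ∫ χ·term_r dν`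
  given `F = Σ_r term_r` pointwise and per-term integrability (`integral_finsetSum`).
* §2 AT THE K2_Liu FRAME (index `X`, point `h`, coarse faces `j ∈ I X h`, fine faces `(j, r)`, `r ∈ R X j`): **`hdec_of_flatTubePresentation`** — the RAW decomposition letter `hdec` of
  `K2LiuIncoherentRankOneFaceRefinement.ac_eq_sum_of_rawDecomposition` with the fine raw blocks EXPLICIT (`A′ X ⟨j,r⟩ s h := ∫ χ_X(u) · (γ · ∏_w Fs(Frpt)) dν_{X,h}`);
  **`hpure_of_flatTubePresentation`** — each fine integrand `= ∏_w Ψloc X ⟨j,r⟩ w s h (FrΩ u w)` with `Ψloc` EXPLICIT as above; **`hAint_of_flatTubePresentation`** — ★ p864260's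
  `hAint` letter for the fine faces with `F X p s h u := ∏_w Ψloc X p w s h (FrΩ u w)` (so its `hpure` is `fun … => rfl`); and the head **`hpure_hAraw_of_flatTubePresentation`** =
  the conjunction the package binds: raw decomposition ∧ fine `hAint` in pure-tensor form, `Ψloc`'s `h`-dependence through the right frame factor `Frg X h w` only.
HONEST LABEL.  Count-neutral helper (finite-product algebra + linearity of the Bochner integral); the readings (E) (T) (M), the integral reading of `A` and the per-term integrability enter
BY VALUE with named ★ payers; `HC_CM` is proved only modulo the 7 printed citations (2 remaining named inputs: hLiu418 = `stmt-HodgeConjecture-24832`, h413 = `stmt-HodgeConjecture-24833`)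
until rung 0 closes.

## References
* [KudlaRallis1994] S. Kudla, S. Rallis, *A regularized Siegel–Weil formula: the first term identity*, Ann. of Math. 140 (1994): §2 (2.10)–(2.12).
* [Shimura1997] G. Shimura, *Euler Products and Eisenstein Series*, CBMS 93 (1997): §16.4 (flat sections on the tube), §18.1 (18.4), §18.4 (`ψ(tr(β n(b)))` place by place).
* [Tate1967] J. Tate, *Fourier analysis in number fields and Hecke's zeta-functions* (Cassels–Fröhlich 1967): §3 Thm. 3.3.1 (factorizable integrands).
* [BorelJacquet1979] A. Borel, H. Jacquet, *Automorphic forms and automorphic representations*, PSPM 33.1 (1979): §4.1.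
-/

set_option autoImplicit false
set_option linter.dupNamespace false -- the mandated namespace repeats `HodgeConjecture.HodgeConjecture`

noncomputable section

open scoped Matrix
open MeasureTheory NumberField NumberField.InfinitePlace IsDedekindDomain
open Literature.NumberTheory.Automorphic Literature.NumberTheory.Automorphic.UnitaryGroup Literature.NumberTheory.GaloisRepresentations
open Literature.NumberTheory.GelbartRogawski1991 Literature.NumberTheory.GelbartRogawski1991.GRConstruction

namespace Summit.HodgeConjecture.HodgeConjecture.Cruxes.HLiu418.K2LiuIncoherentRankOneArchPlacePresentation

open K2LiuSiegelUnipotentFourierDefs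

/-! ## §1 Generic: the character-weighted flat term is a pure tensor through the frame; the integral of a finite presentation splits -/

/-- **THE CHARACTER-WEIGHTED FLAT TERM IS A PURE TENSOR THROUGH THE FRAME.**  Places `σ` (finite, decidable equality, a fixed `w₀`), frame values `M` (a `Mul`), blocks `B` read by `blk`;
the character READ through the frame, `χ = ∏_w eb w (blk (Fru w))` ((E), ★ p863743's shape); a flat term `γ · ∏_w Fs w (Frx w · Fru w · Frg w)` (the (T)-summand at the point whose
frame is `Frx · Fru · Frg`, (M)) ⟹ `χ · (γ · ∏_w Fs w (…)) = ∏_w ([w = w₀ ? γ : 1] · eb w (blk (Fru w)) · Fs w (Frx w · Fru w · Frg w))` — the scalar folded into the place `w₀`.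
[cite: Shimura1997, §18.1 (18.4)] [cite: Tate1967, §3 Thm. 3.3.1] -/
theorem charTerm_eq_prod_frameTensor {σ M B : Type*} [Fintype σ] [DecidableEq σ] [Mul M] (w₀ : σ)
    (blk : M → B) (eb : σ → B → ℂ) (Fru : σ → M) {χ : ℂ} (heb : χ = ∏ w, eb w (blk (Fru w)))
    (γ : ℂ) (Fs : σ → M → ℂ) (Frx Frg : σ → M) :
    χ * (γ * ∏ w, Fs w (Frx w * Fru w * Frg w)) =
      ∏ w, ((if w = w₀ then γ else 1) * eb w (blk (Fru w)) * Fs w (Frx w * Fru w * Frg w)) := by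
  rw [Finset.prod_mul_distrib, Finset.prod_mul_distrib, Finset.prod_ite_eq', if_pos (Finset.mem_univ w₀), heb]
  ring

/-- **THE INTEGRAL OF A FINITE PRESENTATION SPLITS.**  If `F = Σ_{r ∈ R} term r` pointwise and every `χ · term r` is integrable, then `∫ χ·F dν = Σ_{r ∈ R} ∫ χ·term r dν` (linearity of the
Bochner integral, `integral_finsetSum`). [cite: Tate1967, §3 Thm. 3.3.1] [cite: KudlaRallis1994, §2 (2.10)–(2.12)] -/
theorem integral_mul_eq_sum_integral_of_presentation {Ω ρ : Type*} [MeasurableSpace Ω] (ν : Measure Ω) (R : Finset ρ) (χ : Ω → ℂ) (term : ρ → Ω → ℂ)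
    {F : Ω → ℂ} (hpres : ∀ u, F u = ∑ r ∈ R, term r u) (hint : ∀ r ∈ R, Integrable (fun u => χ u * term r u) ν) :
    ∫ u, χ u * F u ∂ν = ∑ r ∈ R, ∫ u, χ u * term r u ∂ν := by
  have h : (fun u => χ u * F u) = fun u => ∑ r ∈ R, χ u * term r u := funext fun u => by rw [hpres u, Finset.mul_sum]
  rw [h, integral_finsetSum R hint]

/-! ## §2 At the K2_Liu frame: the letters of ★ p864260 and of `K2LiuIncoherentRankOneFaceRefinement` for the refined faces -/

section Frame

variable (L : Type) [Field L] [NumberField L] [IsCMField L]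

variable {N M n : ℕ} (e : Fin N × Fin M ≃ Fin n)
  (dV : Fin N → L) (hdV : ∀ i, IsCMField.complexConj L (dV i) = dV i)
  (dW : Fin M → L) (hdW : ∀ i, IsCMField.complexConj L (dW i) = dW i)

/-- **THE RAW FACE DECOMPOSITION `hdec` FROM THE FLAT TUBE PRESENTATION.**  Coarse faces `j ∈ I X h` with raw archimedean block read as an integral of character × face slice at the
translated point (`hAint₀`, ★ p863805 (b)'s witness shape: `A X j s h = ∫ χ X u · Φ X j s h u dν_{X,h}`), the slice presented as a finite sum of flat frame products
(`hpres`: `Φ X j s h u = Σ_{r ∈ R X j} γ X ⟨j,r⟩ s · ∏_w Fs X ⟨j,r⟩ w s (Frpt X h u w)`, ★ `exists_flat_tube_presentation` at `a := x·u·g′`), per-term integrability on `{1 < re}` (`hint`)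
⟹ the letter `hdec` of `K2LiuIncoherentRankOneFaceRefinement.ac_eq_sum_of_rawDecomposition` with the fine raw blocks EXPLICIT:
`A X j s h = Σ_{r ∈ R X j} ∫ χ X u · (γ X ⟨j,r⟩ s · ∏_w Fs X ⟨j,r⟩ w s (Frpt X h u w)) dν_{X,h}` (`1 < re s`). [cite: KudlaRallis1994, §2 (2.10)–(2.12)] [cite: Shimura1997, §16.4] -/
theorem hdec_of_flatTubePresentation {φ ρ Ω σ Mfr : Type*} [MeasurableSpace Ω] [Fintype σ]
    (I : skewMatrices ((IsCMField.complexConj L : L ≃ₐ[Fp L] L) : L →+* L) ((gramR L e dV hdV dW hdW).map (algebraMap (Fp L) L)) → HA L e dV hdV dW hdW → Finset φ)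
    (A : skewMatrices ((IsCMField.complexConj L : L ≃ₐ[Fp L] L) : L →+* L) ((gramR L e dV hdV dW hdW).map (algebraMap (Fp L) L)) → φ → ℂ → HA L e dV hdV dW hdW → ℂ)
    (ν : skewMatrices ((IsCMField.complexConj L : L ≃ₐ[Fp L] L) : L →+* L) ((gramR L e dV hdV dW hdW).map (algebraMap (Fp L) L)) → HA L e dV hdV dW hdW → Measure Ω)
    (χ : skewMatrices ((IsCMField.complexConj L : L ≃ₐ[Fp L] L) : L →+* L) ((gramR L e dV hdV dW hdW).map (algebraMap (Fp L) L)) → Ω → ℂ)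
    (Φ : skewMatrices ((IsCMField.complexConj L : L ≃ₐ[Fp L] L) : L →+* L) ((gramR L e dV hdV dW hdW).map (algebraMap (Fp L) L)) → φ → ℂ → HA L e dV hdV dW hdW → Ω → ℂ)
    (hAint₀ : ∀ X : skewMatrices ((IsCMField.complexConj L : L ≃ₐ[Fp L] L) : L →+* L) ((gramR L e dV hdV dW hdW).map (algebraMap (Fp L) L)),
      (X : Matrix (Fin n) (Fin n) L) ≠ 0 → (X : Matrix (Fin n) (Fin n) L).det = 0 → ∀ (h : HA L e dV hdV dW hdW), ∀ j ∈ I X h, ∀ s : ℂ, 1 < s.re →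
        A X j s h = ∫ u, χ X u * Φ X j s h u ∂(ν X h))
    (R : skewMatrices ((IsCMField.complexConj L : L ≃ₐ[Fp L] L) : L →+* L) ((gramR L e dV hdV dW hdW).map (algebraMap (Fp L) L)) → φ → Finset ρ)
    (γ : skewMatrices ((IsCMField.complexConj L : L ≃ₐ[Fp L] L) : L →+* L) ((gramR L e dV hdV dW hdW).map (algebraMap (Fp L) L)) → (Sigma fun _ : φ => ρ) → ℂ → ℂ)
    (Fs : skewMatrices ((IsCMField.complexConj L : L ≃ₐ[Fp L] L) : L →+* L) ((gramR L e dV hdV dW hdW).map (algebraMap (Fp L) L)) → (Sigma fun _ : φ => ρ) → σ → ℂ → Mfr → ℂ)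
    (Frpt : skewMatrices ((IsCMField.complexConj L : L ≃ₐ[Fp L] L) : L →+* L) ((gramR L e dV hdV dW hdW).map (algebraMap (Fp L) L)) → HA L e dV hdV dW hdW → Ω → σ → Mfr)
    (hpres : ∀ X : skewMatrices ((IsCMField.complexConj L : L ≃ₐ[Fp L] L) : L →+* L) ((gramR L e dV hdV dW hdW).map (algebraMap (Fp L) L)),
      (X : Matrix (Fin n) (Fin n) L) ≠ 0 → (X : Matrix (Fin n) (Fin n) L).det = 0 → ∀ (h : HA L e dV hdV dW hdW), ∀ j ∈ I X h, ∀ (s : ℂ) (u : Ω),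
        Φ X j s h u = ∑ r ∈ R X j, γ X ⟨j, r⟩ s * ∏ w, Fs X ⟨j, r⟩ w s (Frpt X h u w))
    (hint : ∀ X : skewMatrices ((IsCMField.complexConj L : L ≃ₐ[Fp L] L) : L →+* L) ((gramR L e dV hdV dW hdW).map (algebraMap (Fp L) L)),
      (X : Matrix (Fin n) (Fin n) L) ≠ 0 → (X : Matrix (Fin n) (Fin n) L).det = 0 → ∀ (h : HA L e dV hdV dW hdW), ∀ j ∈ I X h, ∀ r ∈ R X j, ∀ s : ℂ, 1 < s.re →
        Integrable (fun u => χ X u * (γ X ⟨j, r⟩ s * ∏ w, Fs X ⟨j, r⟩ w s (Frpt X h u w))) (ν X h)) :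
    ∀ X : skewMatrices ((IsCMField.complexConj L : L ≃ₐ[Fp L] L) : L →+* L) ((gramR L e dV hdV dW hdW).map (algebraMap (Fp L) L)),
      (X : Matrix (Fin n) (Fin n) L) ≠ 0 → (X : Matrix (Fin n) (Fin n) L).det = 0 → ∀ (h : HA L e dV hdV dW hdW), ∀ j ∈ I X h, ∀ s : ℂ, 1 < s.re →
        A X j s h = ∑ r ∈ R X j, ∫ u, χ X u * (γ X ⟨j, r⟩ s * ∏ w, Fs X ⟨j, r⟩ w s (Frpt X h u w)) ∂(ν X h) := by
  intro X hX0 hdet h j hj s hs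
  rw [hAint₀ X hX0 hdet h j hj s hs]
  exact integral_mul_eq_sum_integral_of_presentation (ν X h) (R X j) (χ X) (fun r u => γ X ⟨j, r⟩ s * ∏ w, Fs X ⟨j, r⟩ w s (Frpt X h u w))
    (hpres X hX0 hdet h j hj s) (fun r hr => hint X hX0 hdet h j hj r hr s hs)

/-- **THE FINE INTEGRAND IS A PURE TENSOR THROUGH THE FRAME (`hpure`).**  Frame of the unipotent `FrΩ u w`, of the left point `Frx X w` and of the right point `Frg X h w` with (M)
`Frpt X h u w = Frx X w · FrΩ u w · Frg X h w` (`hFrpt`, ★ `frame_mul`); the character read through the frame (E) `χ X u = ∏_w eb X w (blk (FrΩ u w))` (`heb`, ★ p863743); a fixed place `w₀`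
⟹ for every fine face `p`: `χ X u · (γ X p s · ∏_w Fs X p w s (Frpt X h u w)) = ∏_w Ψloc X p w s h (FrΩ u w)` with
`Ψloc X p w s h m := [w = w₀ ? γ X p s : 1] · eb X w (blk m) · Fs X p w s (Frx X w · m · Frg X h w)` — ★ p864260's `hpure` for the explicit `Ψloc`, whose `h`-dependence is through `Frg X h w` only.
[cite: Shimura1997, §18.1 (18.4)] [cite: Tate1967, §3 Thm. 3.3.1] [cite: BorelJacquet1979, §4.1] -/
theorem hpure_of_flatTubePresentation {κ Ω σ Mfr B : Type*} [Fintype σ] [DecidableEq σ] [Mul Mfr] (w₀ : σ) (blk : Mfr → B)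
    (FrΩ : Ω → σ → Mfr)
    (Frx : skewMatrices ((IsCMField.complexConj L : L ≃ₐ[Fp L] L) : L →+* L) ((gramR L e dV hdV dW hdW).map (algebraMap (Fp L) L)) → σ → Mfr)
    (Frg : skewMatrices ((IsCMField.complexConj L : L ≃ₐ[Fp L] L) : L →+* L) ((gramR L e dV hdV dW hdW).map (algebraMap (Fp L) L)) → HA L e dV hdV dW hdW → σ → Mfr)
    (Frpt : skewMatrices ((IsCMField.complexConj L : L ≃ₐ[Fp L] L) : L →+* L) ((gramR L e dV hdV dW hdW).map (algebraMap (Fp L) L)) → HA L e dV hdV dW hdW → Ω → σ → Mfr)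
    (hFrpt : ∀ (X : skewMatrices ((IsCMField.complexConj L : L ≃ₐ[Fp L] L) : L →+* L) ((gramR L e dV hdV dW hdW).map (algebraMap (Fp L) L))) (h : HA L e dV hdV dW hdW) (u : Ω) (w : σ),
      Frpt X h u w = Frx X w * FrΩ u w * Frg X h w)
    (χ : skewMatrices ((IsCMField.complexConj L : L ≃ₐ[Fp L] L) : L →+* L) ((gramR L e dV hdV dW hdW).map (algebraMap (Fp L) L)) → Ω → ℂ)
    (eb : skewMatrices ((IsCMField.complexConj L : L ≃ₐ[Fp L] L) : L →+* L) ((gramR L e dV hdV dW hdW).map (algebraMap (Fp L) L)) → σ → B → ℂ)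
    (heb : ∀ (X : skewMatrices ((IsCMField.complexConj L : L ≃ₐ[Fp L] L) : L →+* L) ((gramR L e dV hdV dW hdW).map (algebraMap (Fp L) L))) (u : Ω),
      χ X u = ∏ w, eb X w (blk (FrΩ u w)))
    (γ : skewMatrices ((IsCMField.complexConj L : L ≃ₐ[Fp L] L) : L →+* L) ((gramR L e dV hdV dW hdW).map (algebraMap (Fp L) L)) → κ → ℂ → ℂ)
    (Fs : skewMatrices ((IsCMField.complexConj L : L ≃ₐ[Fp L] L) : L →+* L) ((gramR L e dV hdV dW hdW).map (algebraMap (Fp L) L)) → κ → σ → ℂ → Mfr → ℂ) :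
    ∀ (X : skewMatrices ((IsCMField.complexConj L : L ≃ₐ[Fp L] L) : L →+* L) ((gramR L e dV hdV dW hdW).map (algebraMap (Fp L) L))) (p : κ) (s : ℂ)
      (h : HA L e dV hdV dW hdW) (u : Ω),
      χ X u * (γ X p s * ∏ w, Fs X p w s (Frpt X h u w)) =
        ∏ w, (fun X p w s h (m : Mfr) => (if w = w₀ then γ X p s else 1) * eb X w (blk m) * Fs X p w s (Frx X w * m * Frg X h w)) X p w s h (FrΩ u w) := by
  intro X p s h u
  have hF : (fun w => Fs X p w s (Frpt X h u w)) = fun w => Fs X p w s (Frx X w * FrΩ u w * Frg X h w) := funext fun w => by rw [hFrpt X h u w]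
  rw [hF]
  exact charTerm_eq_prod_frameTensor w₀ blk (eb X) (FrΩ u) (heb X u) (γ X p s) (fun w m => Fs X p w s m) (Frx X) (Frg X h)

/-- **★ p864260's `hAint` FOR THE REFINED FACES, IN PURE-TENSOR FORM.**  With the fine raw blocks READ as the term integrals (`hA′int`: `A′ X ⟨j,r⟩ s h = ∫ χ X u · (γ · ∏_w Fs(Frpt)) dν_{X,h}`
— definitional for the assembler after `hdec_of_flatTubePresentation`) and the letters of `hpure_of_flatTubePresentation`: `A′ X p s h = ∫ ∏_w Ψloc X p w s h (FrΩ u w) dν_{X,h}` on `{1 < re}`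
at the fine faces `p ∈ (I X h).sigma (R X)` — ★ `K2LiuIncoherentRankOneArchPlaceTensor.hAinf_of_frameTensor`'s `hAint` with `F X p s h u := ∏_w Ψloc X p w s h (FrΩ u w)` (its `hpure` is then
`fun … => rfl`). [cite: KudlaRallis1994, §2 (2.10)–(2.12)] [cite: Shimura1997, §18.4] -/
theorem hAint_of_flatTubePresentation {φ ρ Ω σ Mfr B : Type*} [MeasurableSpace Ω] [Fintype σ] [DecidableEq σ] [Mul Mfr] (w₀ : σ) (blk : Mfr → B)
    (I : skewMatrices ((IsCMField.complexConj L : L ≃ₐ[Fp L] L) : L →+* L) ((gramR L e dV hdV dW hdW).map (algebraMap (Fp L) L)) → HA L e dV hdV dW hdW → Finset φ)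
    (R : skewMatrices ((IsCMField.complexConj L : L ≃ₐ[Fp L] L) : L →+* L) ((gramR L e dV hdV dW hdW).map (algebraMap (Fp L) L)) → φ → Finset ρ)
    (ν : skewMatrices ((IsCMField.complexConj L : L ≃ₐ[Fp L] L) : L →+* L) ((gramR L e dV hdV dW hdW).map (algebraMap (Fp L) L)) → HA L e dV hdV dW hdW → Measure Ω)
    (FrΩ : Ω → σ → Mfr)
    (Frx : skewMatrices ((IsCMField.complexConj L : L ≃ₐ[Fp L] L) : L →+* L) ((gramR L e dV hdV dW hdW).map (algebraMap (Fp L) L)) → σ → Mfr)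
    (Frg : skewMatrices ((IsCMField.complexConj L : L ≃ₐ[Fp L] L) : L →+* L) ((gramR L e dV hdV dW hdW).map (algebraMap (Fp L) L)) → HA L e dV hdV dW hdW → σ → Mfr)
    (Frpt : skewMatrices ((IsCMField.complexConj L : L ≃ₐ[Fp L] L) : L →+* L) ((gramR L e dV hdV dW hdW).map (algebraMap (Fp L) L)) → HA L e dV hdV dW hdW → Ω → σ → Mfr)
    (hFrpt : ∀ (X : skewMatrices ((IsCMField.complexConj L : L ≃ₐ[Fp L] L) : L →+* L) ((gramR L e dV hdV dW hdW).map (algebraMap (Fp L) L))) (h : HA L e dV hdV dW hdW) (u : Ω) (w : σ),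
      Frpt X h u w = Frx X w * FrΩ u w * Frg X h w)
    (χ : skewMatrices ((IsCMField.complexConj L : L ≃ₐ[Fp L] L) : L →+* L) ((gramR L e dV hdV dW hdW).map (algebraMap (Fp L) L)) → Ω → ℂ)
    (eb : skewMatrices ((IsCMField.complexConj L : L ≃ₐ[Fp L] L) : L →+* L) ((gramR L e dV hdV dW hdW).map (algebraMap (Fp L) L)) → σ → B → ℂ)
    (heb : ∀ (X : skewMatrices ((IsCMField.complexConj L : L ≃ₐ[Fp L] L) : L →+* L) ((gramR L e dV hdV dW hdW).map (algebraMap (Fp L) L))) (u : Ω),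
      χ X u = ∏ w, eb X w (blk (FrΩ u w)))
    (γ : skewMatrices ((IsCMField.complexConj L : L ≃ₐ[Fp L] L) : L →+* L) ((gramR L e dV hdV dW hdW).map (algebraMap (Fp L) L)) → (Sigma fun _ : φ => ρ) → ℂ → ℂ)
    (Fs : skewMatrices ((IsCMField.complexConj L : L ≃ₐ[Fp L] L) : L →+* L) ((gramR L e dV hdV dW hdW).map (algebraMap (Fp L) L)) → (Sigma fun _ : φ => ρ) → σ → ℂ → Mfr → ℂ)
    (A' : skewMatrices ((IsCMField.complexConj L : L ≃ₐ[Fp L] L) : L →+* L) ((gramR L e dV hdV dW hdW).map (algebraMap (Fp L) L)) → (Sigma fun _ : φ => ρ) → ℂ →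
      HA L e dV hdV dW hdW → ℂ)
    (hA'int : ∀ X : skewMatrices ((IsCMField.complexConj L : L ≃ₐ[Fp L] L) : L →+* L) ((gramR L e dV hdV dW hdW).map (algebraMap (Fp L) L)),
      (X : Matrix (Fin n) (Fin n) L) ≠ 0 → (X : Matrix (Fin n) (Fin n) L).det = 0 → ∀ (h : HA L e dV hdV dW hdW), ∀ j ∈ I X h, ∀ r ∈ R X j, ∀ s : ℂ, 1 < s.re →
        A' X ⟨j, r⟩ s h = ∫ u, χ X u * (γ X ⟨j, r⟩ s * ∏ w, Fs X ⟨j, r⟩ w s (Frpt X h u w)) ∂(ν X h)) :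
    ∀ X : skewMatrices ((IsCMField.complexConj L : L ≃ₐ[Fp L] L) : L →+* L) ((gramR L e dV hdV dW hdW).map (algebraMap (Fp L) L)),
      (X : Matrix (Fin n) (Fin n) L) ≠ 0 → (X : Matrix (Fin n) (Fin n) L).det = 0 → ∀ (h : HA L e dV hdV dW hdW), ∀ p ∈ (I X h).sigma (R X), ∀ s : ℂ, 1 < s.re →
        A' X p s h = ∫ u, (fun X p s h u => ∏ w, (fun X p w s h (m : Mfr) => (if w = w₀ then γ X p s else 1) * eb X w (blk m) * Fs X p w s (Frx X w * m * Frg X h w))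
          X p w s h (FrΩ u w)) X p s h u ∂(ν X h) := by
  intro X hX0 hdet h p hp s hs
  obtain ⟨hj, hr⟩ := Finset.mem_sigma.1 hp
  rw [hA'int X hX0 hdet h p.1 hj p.2 hr s hs]
  exact congrArg _ (funext fun u => hpure_of_flatTubePresentation L e dV hdV dW hdW w₀ blk FrΩ Frx Frg Frpt hFrpt χ eb heb γ Fs X p s h u)

/-- **THE HEAD: `hpure`∕`hAraw` OF ★ p864260 FROM THE FLAT TUBE PRESENTATION (cut (α), refined faces).**  Under the readings (E) `heb`, (T) `hpres`, (M) `hFrpt`, the integral reading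
`hAint₀` of the coarse raw blocks and per-term integrability on `{1 < re}`: (i) the RAW FACE DECOMPOSITION (`K2LiuIncoherentRankOneFaceRefinement`'s `hdec`) with explicit fine raw blocks,
and (ii) for those fine raw blocks, ★ p864260's `hAint` IN PURE-TENSOR FORM — `= ∫ ∏_w Ψloc X p w s h (FrΩ u w) dν_{X,h}` with
`Ψloc X p w s h m := [w = w₀ ? γ X p s : 1] · eb X w (blk m) · Fs X p w s (Frx X w · m · Frg X h w)` (so ★ p864260's `hpure` is `rfl` and its `hAraw` is `rfl` at
`Araw X p w s g := ∫ Ψloc(…)(Frg := g)(nfr ρ) dρ`, `comp X h w := Frg X h w` — the `h`-dependence is through the right frame factor ONLY, as the second reader asked).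
[cite: KudlaRallis1994, §2 (2.10)–(2.12)] [cite: Shimura1997, §16.4, §18.4] [cite: Tate1967, §3 Thm. 3.3.1] -/
theorem hpure_hAraw_of_flatTubePresentation {φ ρ Ω σ Mfr B : Type*} [MeasurableSpace Ω] [Fintype σ] [DecidableEq σ] [Mul Mfr] (w₀ : σ) (blk : Mfr → B)
    (I : skewMatrices ((IsCMField.complexConj L : L ≃ₐ[Fp L] L) : L →+* L) ((gramR L e dV hdV dW hdW).map (algebraMap (Fp L) L)) → HA L e dV hdV dW hdW → Finset φ)
    (A : skewMatrices ((IsCMField.complexConj L : L ≃ₐ[Fp L] L) : L →+* L) ((gramR L e dV hdV dW hdW).map (algebraMap (Fp L) L)) → φ → ℂ → HA L e dV hdV dW hdW → ℂ)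
    (ν : skewMatrices ((IsCMField.complexConj L : L ≃ₐ[Fp L] L) : L →+* L) ((gramR L e dV hdV dW hdW).map (algebraMap (Fp L) L)) → HA L e dV hdV dW hdW → Measure Ω)
    -- (M) the frames of the unipotent, of the left point and of the right point, and the frame of the translated point
    (FrΩ : Ω → σ → Mfr)
    (Frx : skewMatrices ((IsCMField.complexConj L : L ≃ₐ[Fp L] L) : L →+* L) ((gramR L e dV hdV dW hdW).map (algebraMap (Fp L) L)) → σ → Mfr)
    (Frg : skewMatrices ((IsCMField.complexConj L : L ≃ₐ[Fp L] L) : L →+* L) ((gramR L e dV hdV dW hdW).map (algebraMap (Fp L) L)) → HA L e dV hdV dW hdW → σ → Mfr)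
    (Frpt : skewMatrices ((IsCMField.complexConj L : L ≃ₐ[Fp L] L) : L →+* L) ((gramR L e dV hdV dW hdW).map (algebraMap (Fp L) L)) → HA L e dV hdV dW hdW → Ω → σ → Mfr)
    (hFrpt : ∀ (X : skewMatrices ((IsCMField.complexConj L : L ≃ₐ[Fp L] L) : L →+* L) ((gramR L e dV hdV dW hdW).map (algebraMap (Fp L) L))) (h : HA L e dV hdV dW hdW) (u : Ω) (w : σ),
      Frpt X h u w = Frx X w * FrΩ u w * Frg X h w)
    -- (E) the character read through the frame
    (χ : skewMatrices ((IsCMField.complexConj L : L ≃ₐ[Fp L] L) : L →+* L) ((gramR L e dV hdV dW hdW).map (algebraMap (Fp L) L)) → Ω → ℂ)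
    (eb : skewMatrices ((IsCMField.complexConj L : L ≃ₐ[Fp L] L) : L →+* L) ((gramR L e dV hdV dW hdW).map (algebraMap (Fp L) L)) → σ → B → ℂ)
    (heb : ∀ (X : skewMatrices ((IsCMField.complexConj L : L ≃ₐ[Fp L] L) : L →+* L) ((gramR L e dV hdV dW hdW).map (algebraMap (Fp L) L))) (u : Ω),
      χ X u = ∏ w, eb X w (blk (FrΩ u w)))
    -- the coarse raw block as an integral, (T) the flat tube presentation of the slice at the translated point, per-term integrability
    (Φ : skewMatrices ((IsCMField.complexConj L : L ≃ₐ[Fp L] L) : L →+* L) ((gramR L e dV hdV dW hdW).map (algebraMap (Fp L) L)) → φ → ℂ → HA L e dV hdV dW hdW → Ω → ℂ)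
    (hAint₀ : ∀ X : skewMatrices ((IsCMField.complexConj L : L ≃ₐ[Fp L] L) : L →+* L) ((gramR L e dV hdV dW hdW).map (algebraMap (Fp L) L)),
      (X : Matrix (Fin n) (Fin n) L) ≠ 0 → (X : Matrix (Fin n) (Fin n) L).det = 0 → ∀ (h : HA L e dV hdV dW hdW), ∀ j ∈ I X h, ∀ s : ℂ, 1 < s.re →
        A X j s h = ∫ u, χ X u * Φ X j s h u ∂(ν X h))
    (R : skewMatrices ((IsCMField.complexConj L : L ≃ₐ[Fp L] L) : L →+* L) ((gramR L e dV hdV dW hdW).map (algebraMap (Fp L) L)) → φ → Finset ρ)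
    (γ : skewMatrices ((IsCMField.complexConj L : L ≃ₐ[Fp L] L) : L →+* L) ((gramR L e dV hdV dW hdW).map (algebraMap (Fp L) L)) → (Sigma fun _ : φ => ρ) → ℂ → ℂ)
    (Fs : skewMatrices ((IsCMField.complexConj L : L ≃ₐ[Fp L] L) : L →+* L) ((gramR L e dV hdV dW hdW).map (algebraMap (Fp L) L)) → (Sigma fun _ : φ => ρ) → σ → ℂ → Mfr → ℂ)
    (hpres : ∀ X : skewMatrices ((IsCMField.complexConj L : L ≃ₐ[Fp L] L) : L →+* L) ((gramR L e dV hdV dW hdW).map (algebraMap (Fp L) L)),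
      (X : Matrix (Fin n) (Fin n) L) ≠ 0 → (X : Matrix (Fin n) (Fin n) L).det = 0 → ∀ (h : HA L e dV hdV dW hdW), ∀ j ∈ I X h, ∀ (s : ℂ) (u : Ω),
        Φ X j s h u = ∑ r ∈ R X j, γ X ⟨j, r⟩ s * ∏ w, Fs X ⟨j, r⟩ w s (Frpt X h u w))
    (hint : ∀ X : skewMatrices ((IsCMField.complexConj L : L ≃ₐ[Fp L] L) : L →+* L) ((gramR L e dV hdV dW hdW).map (algebraMap (Fp L) L)),
      (X : Matrix (Fin n) (Fin n) L) ≠ 0 → (X : Matrix (Fin n) (Fin n) L).det = 0 → ∀ (h : HA L e dV hdV dW hdW), ∀ j ∈ I X h, ∀ r ∈ R X j, ∀ s : ℂ, 1 < s.re →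
        Integrable (fun u => χ X u * (γ X ⟨j, r⟩ s * ∏ w, Fs X ⟨j, r⟩ w s (Frpt X h u w))) (ν X h)) :
    -- (i) the raw face decomposition with explicit fine raw blocks
    (∀ X : skewMatrices ((IsCMField.complexConj L : L ≃ₐ[Fp L] L) : L →+* L) ((gramR L e dV hdV dW hdW).map (algebraMap (Fp L) L)),
      (X : Matrix (Fin n) (Fin n) L) ≠ 0 → (X : Matrix (Fin n) (Fin n) L).det = 0 → ∀ (h : HA L e dV hdV dW hdW), ∀ j ∈ I X h, ∀ s : ℂ, 1 < s.re →
        A X j s h = ∑ r ∈ R X j,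
          (fun X (p : Sigma fun _ : φ => ρ) s h => ∫ u, χ X u * (γ X p s * ∏ w, Fs X p w s (Frpt X h u w)) ∂(ν X h)) X ⟨j, r⟩ s h) ∧
    -- (ii) the fine raw blocks in pure-tensor form (★ p864260's `hAint` with `hpure := rfl`)
    (∀ X : skewMatrices ((IsCMField.complexConj L : L ≃ₐ[Fp L] L) : L →+* L) ((gramR L e dV hdV dW hdW).map (algebraMap (Fp L) L)),
      (X : Matrix (Fin n) (Fin n) L) ≠ 0 → (X : Matrix (Fin n) (Fin n) L).det = 0 → ∀ (h : HA L e dV hdV dW hdW), ∀ p ∈ (I X h).sigma (R X), ∀ s : ℂ, 1 < s.re →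
        (fun X (p : Sigma fun _ : φ => ρ) s h => ∫ u, χ X u * (γ X p s * ∏ w, Fs X p w s (Frpt X h u w)) ∂(ν X h)) X p s h =
          ∫ u, (fun X p s h u => ∏ w, (fun X p w s h (m : Mfr) => (if w = w₀ then γ X p s else 1) * eb X w (blk m) * Fs X p w s (Frx X w * m * Frg X h w))
            X p w s h (FrΩ u w)) X p s h u ∂(ν X h)) :=
  ⟨hdec_of_flatTubePresentation L e dV hdV dW hdW I A ν χ Φ hAint₀ R γ Fs Frpt hpres hint,
    hAint_of_flatTubePresentation L e dV hdV dW hdW w₀ blk I R ν FrΩ Frx Frg Frpt hFrpt χ eb heb γ Fs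
      (fun X p s h => ∫ u, χ X u * (γ X p s * ∏ w, Fs X p w s (Frpt X h u w)) ∂(ν X h)) (fun _ _ _ _ _ _ _ _ _ _ => rfl)⟩

end Frame

end Summit.HodgeConjecture.HodgeConjecture.Cruxes.HLiu418.K2LiuIncoherentRankOneArchPlacePresentation

end
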